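import Summits.AtomisticToContinuum.Crystallization.Theorems.FreeSplittingCertificatesStrictSplittingRuleFarTransferOctSharpPoly
import Summits.AtomisticToContinuum.Crystallization.Theorems.FreeSplittingCertificatesStrictSplittingRuleFarTransferOctDownSharpTetsA
import Summits.AtomisticToContinuum.Crystallization.Theorems.FreeSplittingCertificatesStrictSplittingRuleFarTransferOctDownSharpTetsB

/-!
# `StrictSplittingRule` (stmt-AtomisticToContinuum-12560): SHARP octahedron receipts certificate — the DOWN octahedron: `a⁴·Σ_τ fpRec Gτ ≤ 16·Σ₁₂⟪y_e, Δ_e w⟫²`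

Route `FreeSplittingCertificates`, crux r3 `StrictSplittingRule` (H12⋆ = `stub_coreJointCoercive`), unit b2b-freesplit-B gen 13.
VALUE = part of a kernel-checked certificate making the element algebra of the lattice→continuum transfer SUFFICIENT (HOME FAR-LEMMA-SPEC §11,
CERT §20 (1b)) — NOT a proof of H12⋆, NOT summit progress.  MACHINE-GENERATED by `code/partB/gen13-lean/sharp3.py` (sympy + mpmath; exact rational
arithmetic), kernel-checked; do not edit by hand.

Context.  The crude octahedron constant of `hcpOct*_receipts` (`504`, i.e. `a⁴Σ_τ fpRec ≤ 1134·Σ₁₂dl²` at the hcp ratio) misses the bond-by-bond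
transfer budget by ≈ 5×; the sharp constant of the same inequality is `13.77` (affine fields `4`).  The certificate proves the constant `16` on the
ratio box `81619/100000·a ≤ h ≤ 81657/100000·a` of the hcp-family minimiser: in the isostatic coordinates `q ∈ ℝ¹²` (the twelve edge readouts)
`N(q; a, h) := Σ_τ (a²h²)²·fpRec Gτ` is an explicit RATIONAL quadratic form (files `…OctUpSharpTets` / `…OctDownSharpTets`; the same polynomial for
both orientations by the mirror symmetry) and `N ≤ 16·h⁴·Σq²` on the box (files `…SharpTaylor`, `…SharpF0`, `…SharpFk`, `…SharpPoly`): Taylor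
expansion in `h − t₀a` (`t₀ = 40819/50000`, `|h − t₀a| ≤ a/5000`), `F₀ ⪰ 0.899999·Σq²` (rounded Cholesky + Gershgorin sums of squares), `|F_k| ≤
(53, 98, 82, 26)·Σq²` (Gershgorin sums of squares), `0.899999 − Σ_k r_k/5000^k > 0`; assembled in `hcpOctUp_receipts_sharp` / `hcpOctDown_receipts_sharp`.
THIS FILE: `hcpOctDown_receipts_sharp`.
-/

noncomputable section

namespace Summit.AtomisticToContinuum.Crystallization.Theorems.StrictSplittingRuleBirth

open scoped BigOperators
open Literature.MathematicalPhysics.StatisticalMechanics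
open Summit.AtomisticToContinuum.Crystallization.Theorems.PalmUnimodularRigidity.LayeredLawsSelectHcp
open Summit.AtomisticToContinuum.Crystallization.Theorems.PhononStabilityCWC.Cert (inner_fin3)

set_option maxHeartbeats 1600000 in
set_option maxRecDepth 8192 in
/-- **SHARP receipts lemma for the DOWN octahedron** (vertices as in `hcpOctDown_receipts`): for `(a, h)` in the ratio box of the
hcp-family minimiser (`81619/100000·a ≤ h ≤ 81657/100000·a`, implied by `hcpFamilyMin_enclosure`), ARBITRARY vertex displacements
`w₀,…,w₅` and the P1 gradients `G₁,…,G₄` on the four quarter-tetrahedra around the diagonal (hypotheses: `Gτ` maps the three edge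
vectors from `B₁` to the displacement differences), `a⁴·Σ_τ fpRec Gτ ≤ 16·Σ_{12 edges}⟪y_e, w_head − w_tail⟫²`.  The sharp constant is
`13.77` (generalised eigenvalue, gen-13 `sharp_consts.py`; affine fields `4`); `16` closes the bond-by-bond transfer budget of FAR-LEMMA-SPEC §11
with ≈ 4× slack, which the crude `504` of `hcpOctDown_receipts` does not.  Proof: the isostatic octahedron's twelve edge readouts are
coordinates modulo rigid motions; `(a²h²)²fpRec Gτ` is an explicit rational quadratic form in them (`hcpOctDown_fpRec_tet1…4`), and the
polynomial certificate `octSharp_poly_le` (Taylor in `h − t₀a`, exact rational sums of squares) bounds the total. [folklore] -/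
theorem hcpOctDown_receipts_sharp (a h : ℝ) (ha : 0 < a) (hlo : 81619 / 100000 * a ≤ h) (hhi : h ≤ 81657 / 100000 * a)
    (w₀ w₁ w₂ w₃ w₄ w₅ : EuclideanSpace ℝ (Fin 3)) (G₁ G₂ G₃ G₄ : Fin 3 → Fin 3 → ℝ)
    (h14 : ∀ i, w₄ i - w₀ i = G₁ i 0 * hcpSite a h (-1, 1, -1) 0 + G₁ i 1 * hcpSite a h (-1, 1, -1) 1 + G₁ i 2 * hcpSite a h (-1, 1, -1) 2)
    (h11 : ∀ i, w₁ i - w₀ i = G₁ i 0 * hcpSite a h (0, 1, 0) 0 + G₁ i 1 * hcpSite a h (0, 1, 0) 1 + G₁ i 2 * hcpSite a h (0, 1, 0) 2)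
    (h12 : ∀ i, w₂ i - w₀ i = G₁ i 0 * hcpSite a h (0, 1, -1) 0 + G₁ i 1 * hcpSite a h (0, 1, -1) 1 + G₁ i 2 * hcpSite a h (0, 1, -1) 2)
    (h24 : ∀ i, w₄ i - w₀ i = G₂ i 0 * hcpSite a h (-1, 1, -1) 0 + G₂ i 1 * hcpSite a h (-1, 1, -1) 1 + G₂ i 2 * hcpSite a h (-1, 1, -1) 2)
    (h22 : ∀ i, w₂ i - w₀ i = G₂ i 0 * hcpSite a h (0, 1, -1) 0 + G₂ i 1 * hcpSite a h (0, 1, -1) 1 + G₂ i 2 * hcpSite a h (0, 1, -1) 2)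
    (h23 : ∀ i, w₃ i - w₀ i = G₂ i 0 * hcpSite a h (-1, 0, -1) 0 + G₂ i 1 * hcpSite a h (-1, 0, -1) 1 + G₂ i 2 * hcpSite a h (-1, 0, -1) 2)
    (h34 : ∀ i, w₄ i - w₀ i = G₃ i 0 * hcpSite a h (-1, 1, -1) 0 + G₃ i 1 * hcpSite a h (-1, 1, -1) 1 + G₃ i 2 * hcpSite a h (-1, 1, -1) 2)
    (h33 : ∀ i, w₃ i - w₀ i = G₃ i 0 * hcpSite a h (-1, 0, -1) 0 + G₃ i 1 * hcpSite a h (-1, 0, -1) 1 + G₃ i 2 * hcpSite a h (-1, 0, -1) 2)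
    (h35 : ∀ i, w₅ i - w₀ i = G₃ i 0 * hcpSite a h (-1, 0, 0) 0 + G₃ i 1 * hcpSite a h (-1, 0, 0) 1 + G₃ i 2 * hcpSite a h (-1, 0, 0) 2)
    (h44 : ∀ i, w₄ i - w₀ i = G₄ i 0 * hcpSite a h (-1, 1, -1) 0 + G₄ i 1 * hcpSite a h (-1, 1, -1) 1 + G₄ i 2 * hcpSite a h (-1, 1, -1) 2)
    (h45 : ∀ i, w₅ i - w₀ i = G₄ i 0 * hcpSite a h (-1, 0, 0) 0 + G₄ i 1 * hcpSite a h (-1, 0, 0) 1 + G₄ i 2 * hcpSite a h (-1, 0, 0) 2)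
    (h41 : ∀ i, w₁ i - w₀ i = G₄ i 0 * hcpSite a h (0, 1, 0) 0 + G₄ i 1 * hcpSite a h (0, 1, 0) 1 + G₄ i 2 * hcpSite a h (0, 1, 0) 2) :
    a ^ 4 * (fpRec G₁ + fpRec G₂ + fpRec G₃ + fpRec G₄) ≤
      16 * (inner ℝ (hcpSite a h (0, 1, 0)) (w₁ - w₀) ^ 2 +
        inner ℝ (hcpSite a h (0, 1, -1)) (w₂ - w₀) ^ 2 +
        inner ℝ (hcpSite a h (-1, 0, -1)) (w₃ - w₀) ^ 2 +
        inner ℝ (hcpSite a h (-1, 0, 0)) (w₅ - w₀) ^ 2 +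
        inner ℝ (hcpSite a h (-1, 0, -1)) (w₄ - w₁) ^ 2 +
        inner ℝ (hcpSite a h (-1, 0, 0)) (w₄ - w₂) ^ 2 +
        inner ℝ (hcpSite a h (0, 1, 0)) (w₄ - w₃) ^ 2 +
        inner ℝ (hcpSite a h (0, 1, -1)) (w₄ - w₅) ^ 2 +
        inner ℝ (hcpSite a h (0, 0, -1)) (w₂ - w₁) ^ 2 +
        inner ℝ (hcpSite a h (-1, -1, 0)) (w₅ - w₁) ^ 2 +
        inner ℝ (hcpSite a h (-1, -1, 0)) (w₃ - w₂) ^ 2 +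
        inner ℝ (hcpSite a h (0, 0, 1)) (w₅ - w₃) ^ 2) := by
  set q0 : ℝ := inner ℝ (hcpSite a h (0, 1, 0)) (w₁ - w₀) with hq0
  set q1 : ℝ := inner ℝ (hcpSite a h (0, 1, -1)) (w₂ - w₀) with hq1
  set q2 : ℝ := inner ℝ (hcpSite a h (-1, 0, -1)) (w₃ - w₀) with hq2
  set q3 : ℝ := inner ℝ (hcpSite a h (-1, 0, 0)) (w₅ - w₀) with hq3
  set q4 : ℝ := inner ℝ (hcpSite a h (-1, 0, -1)) (w₄ - w₁) with hq4
  set q5 : ℝ := inner ℝ (hcpSite a h (-1, 0, 0)) (w₄ - w₂) with hq5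
  set q6 : ℝ := inner ℝ (hcpSite a h (0, 1, 0)) (w₄ - w₃) with hq6
  set q7 : ℝ := inner ℝ (hcpSite a h (0, 1, -1)) (w₄ - w₅) with hq7
  set q8 : ℝ := inner ℝ (hcpSite a h (0, 0, -1)) (w₂ - w₁) with hq8
  set q9 : ℝ := inner ℝ (hcpSite a h (-1, -1, 0)) (w₅ - w₁) with hq9
  set q10 : ℝ := inner ℝ (hcpSite a h (-1, -1, 0)) (w₃ - w₂) with hq10
  set q11 : ℝ := inner ℝ (hcpSite a h (0, 0, 1)) (w₅ - w₃) with hq11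
  have e1 := hcpOctDown_fpRec_tet1 a h w₀ w₁ w₂ w₃ w₄ w₅ G₁ q0 q1 q2 q3 q4 q5 q6 q7 q8 q9 q10 q11 h14 h11 h12 hq0 hq1 hq2 hq3 hq4 hq5 hq6 hq7 hq8 hq9 hq10 hq11
  have e2 := hcpOctDown_fpRec_tet2 a h w₀ w₁ w₂ w₃ w₄ w₅ G₂ q0 q1 q2 q3 q4 q5 q6 q7 q8 q9 q10 q11 h24 h22 h23 hq0 hq1 hq2 hq3 hq4 hq5 hq6 hq7 hq8 hq9 hq10 hq11
  have e3 := hcpOctDown_fpRec_tet3 a h w₀ w₁ w₂ w₃ w₄ w₅ G₃ q0 q1 q2 q3 q4 q5 q6 q7 q8 q9 q10 q11 h34 h33 h35 hq0 hq1 hq2 hq3 hq4 hq5 hq6 hq7 hq8 hq9 hq10 hq11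
  have e4 := hcpOctDown_fpRec_tet4 a h w₀ w₁ w₂ w₃ w₄ w₅ G₄ q0 q1 q2 q3 q4 q5 q6 q7 q8 q9 q10 q11 h44 h45 h41 hq0 hq1 hq2 hq3 hq4 hq5 hq6 hq7 hq8 hq9 hq10 hq11
  have P := octSharp_poly_le a h ha hlo hhi q0 q1 q2 q3 q4 q5 q6 q7 q8 q9 q10 q11
  have hh : 0 < h := by linarith
  have hh4 : 0 < h ^ 4 := by positivity
  have key : h ^ 4 * (a ^ 4 * (fpRec G₁ + fpRec G₂ + fpRec G₃ + fpRec G₄)) ≤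
      h ^ 4 * (16 * (q0 ^ 2 + q1 ^ 2 + q2 ^ 2 + q3 ^ 2 + q4 ^ 2 + q5 ^ 2 + q6 ^ 2 + q7 ^ 2 + q8 ^ 2 + q9 ^ 2 + q10 ^ 2 + q11 ^ 2)) := by
    have : h ^ 4 * (a ^ 4 * (fpRec G₁ + fpRec G₂ + fpRec G₃ + fpRec G₄)) =
        (a ^ 2 * h ^ 2) ^ 2 * fpRec G₁ + (a ^ 2 * h ^ 2) ^ 2 * fpRec G₂ + (a ^ 2 * h ^ 2) ^ 2 * fpRec G₃ + (a ^ 2 * h ^ 2) ^ 2 * fpRec G₄ := by ring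
    rw [this, e1, e2, e3, e4]
    linarith [P]
  exact le_of_mul_le_mul_left key hh4
end Summit.AtomisticToContinuum.Crystallization.Theorems.StrictSplittingRuleBirth

end
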